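import Mathlib.Algebra.Module.ZLattice.Covolume
import Mathlib.MeasureTheory.Group.FundamentalDomain
import Mathlib.MeasureTheory.Measure.Lebesgue.VolumeOfBalls
import Mathlib.MeasureTheory.Measure.Haar.Unique
import HarnessLib

/-!
# Covering radius versus covolume: a set of measure `< covol(L)` misses some coset of `L`;
# the open corner simplex `{y > 0, ∑ y < R}` has volume `≤ R^d / d!`

Topic `Literature/Algebra/EuclideanLattices` (geometry of numbers). PROOF FILE: theorems only
(no definition, no named fact; net debt 0).

## 1. The volumetric covering-radius bound, in set form

For a countable group `G` acting measurably on `α` with a `G`-invariant measure `μ` and a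
fundamental domain `s`: if the translates `g +ᵥ t`, `g ∈ G`, of a set `t` COVER `α`, then
`μ s ≤ μ t` (`measure_fundamentalDomain_le_of_forall_exists_vadd_mem`) — the covering counterpart of
Mathlib's packing lemma `MeasureTheory.IsAddFundamentalDomain.measure_le_of_pairwise_disjoint`
(same three-line proof, read through `IsAddFundamentalDomain.measure_eq_tsum`). For a full
`ℤ`-lattice `L` in a finite-dimensional real vector space with Haar measure `μ` this is the usual
"`vol(B) · #cosets ≥ covol`" principle; we state its contrapositive set form
`exists_forall_add_notMem_of_measure_lt_covolume`: if `μ B < covol(L)` then some coset `x + L`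
misses `B` entirely. Applied to the open ball `B` of radius `r` of an (asymmetric) norm this is the
"in particular" clause of [DucasPlanconWesolowski2019, Prop. 1 p. 19]: the covering radius of `L`
in that norm is `≥ (covol L / vol B₁)^{1/d}`.

## 2. The open corner simplex

`volume_openCornerSimplex_le`: for a finite nonempty index type `ι` (`d = card ι`) and `R ≥ 0`,
`vol {y : ι → ℝ | (∀ i, 0 < yᵢ) ∧ ∑ yᵢ < R} ≤ R^d / d!`. Proof without integration: the `2^d`
coordinate sign-reflections of the simplex are pairwise disjoint subsets of the `ℓ¹`-ball
`{∑ |xᵢ| < R}`, whose volume `2^d · R^d / d!` is Mathlib's `MeasureTheory.volume_sum_rpow_lt` at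
`p = 1` (`volume_sum_abs_lt`; the closed unit cross-polytope on `Fin q` is
`Literature.NumberTheory.DiophantineGeometry.volume_sum_abs_le_one`). Equality holds (the exact
value on `Fin n`, `R = 1` is the case `b = 1, c = 1` of the Dirichlet integral
`Literature.Analysis.SpecialFunctions.lintegral_openSimplex_dirichletDensity`); only `≤` is proved
here, which is what volumetric LOWER bounds consume (e.g. the simplex-gauge covering radius of the
log-unit lattice, [DucasPlanconWesolowski2019, §6.2 p. 21]).

## References

* L. Ducas, M. Plançon, B. Wesolowski, *On the shortness of vectors to be found by the Ideal-SVP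
  quantum algorithm*, CRYPTO 2019, Prop. 1 p. 19, §6.2 p. 21 [DucasPlanconWesolowski2019].
* P. M. Gruber, C. G. Lekkerkerker, *Geometry of Numbers*, 2nd ed., North-Holland 1987, Ch. 2 §13
  (covering constant `≥ 1`: `vol(B) ≥ d(L)` for a covering by translates of `B`).
-/

noncomputable section

open MeasureTheory Module

namespace Literature.Algebra.EuclideanLattices

/-! ## 1. Covering ⇒ the fundamental domain is not larger than the covering set -/

section Cover

open scoped Pointwise

/-- If the translates `g +ᵥ t` of a set `t` under a countable group acting with an invariant measure
cover the space, then any fundamental domain `s` has measure at most `μ t`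
(the covering counterpart of `IsAddFundamentalDomain.measure_le_of_pairwise_disjoint`; the step
«Vol(B mod L) ≤ Vol(B)» of the cited proof, read for a covering family).
[cite: DucasPlanconWesolowski2019, Prop. 1 p. 19 (proof)] -/
theorem measure_fundamentalDomain_le_of_forall_exists_vadd_mem {G α : Type*} [AddGroup G]
    [AddAction G α] [MeasurableSpace α] {s t : Set α} {μ : Measure α} [MeasurableConstVAdd G α]
    [VAddInvariantMeasure G α μ] [Countable G] (h : IsAddFundamentalDomain G s μ)
    (ht : ∀ x : α, ∃ g : G, g +ᵥ x ∈ t) : μ s ≤ μ t :=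
  calc μ s ≤ μ (⋃ g : G, (g +ᵥ t) ∩ s) := by
        refine measure_mono fun x hx => ?_
        obtain ⟨g, hg⟩ := ht x
        refine Set.mem_iUnion.mpr ⟨-g, Set.mem_inter ?_ hx⟩
        exact Set.mem_vadd_set.mpr ⟨g +ᵥ x, hg, neg_vadd_vadd g x⟩
    _ ≤ ∑' g : G, μ ((g +ᵥ t) ∩ s) := measure_iUnion_le _
    _ = μ t := (h.measure_eq_tsum t).symm

/-- COVERING RADIUS FROM COVOLUME (set form). If `B` has Haar measure `< covol(L)` for a full
`ℤ`-lattice `L`, then some coset `x + L` misses `B`: `∃ x, ∀ v ∈ L, v + x ∉ B` (else the translates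
`B − v` cover, and a fundamental domain `F` would have `covol L = μ F ≤ μ B`). With `B` the open
`r`-ball of an asymmetric norm this is the "in particular" clause of
[cite: DucasPlanconWesolowski2019, Prop. 1 p. 19]. -/
theorem exists_forall_add_notMem_of_measure_lt_covolume {E : Type*} [NormedAddCommGroup E]
    [NormedSpace ℝ E] [FiniteDimensional ℝ E] [MeasurableSpace E] [BorelSpace E]
    (L : Submodule ℤ E) [DiscreteTopology L] [IsZLattice ℝ L] (μ : Measure E)
    [Measure.IsAddHaarMeasure μ] {B : Set E} (hB : μ B < ENNReal.ofReal (ZLattice.covolume L μ)) :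
    ∃ x : E, ∀ v ∈ L, v + x ∉ B := by
  by_contra! H
  have hF := ZLattice.isAddFundamentalDomain (Module.Free.chooseBasis ℤ L) μ
  have i1 : MeasurableVAdd L E := (inferInstance : MeasurableVAdd L.toAddSubgroup E)
  have i2 : VAddInvariantMeasure L E μ := (inferInstance : VAddInvariantMeasure L.toAddSubgroup E μ)
  have hle := measure_fundamentalDomain_le_of_forall_exists_vadd_mem hF (t := B) fun x => by
    obtain ⟨v, hv, h⟩ := H x
    exact ⟨⟨v, hv⟩, h⟩
  have hcov := ZLattice.covolume_eq_measure_fundamentalDomain L μ hF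
  have hge : ENNReal.ofReal (ZLattice.covolume L μ) ≤
      μ (ZSpan.fundamentalDomain ((Module.Free.chooseBasis ℤ L).ofZLatticeBasis ℝ L)) := by
    rw [hcov, measureReal_def]
    exact ENNReal.ofReal_toReal_le
  exact absurd (hge.trans hle) (not_le.mpr hB)

end Cover

/-! ## 2. The open corner simplex `{y > 0, ∑ y < R}` has volume `≤ R^d / d!` -/

section Simplex

open Finset

variable {ι : Type*} [Fintype ι]

/-- The open corner simplex `{y | (∀ i, 0 < y i) ∧ ∑ y i < R}` is measurable. [folklore] -/
private theorem measurableSet_openCornerSimplex (R : ℝ) :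
    MeasurableSet {y : ι → ℝ | (∀ i, 0 < y i) ∧ ∑ i, y i < R} := by
  rw [Set.setOf_and, Set.setOf_forall]
  refine MeasurableSet.inter (MeasurableSet.iInter fun i => ?_) ?_
  · exact measurableSet_lt measurable_const (measurable_pi_apply i)
  · exact measurableSet_lt (Finset.measurable_sum _ fun i _ => measurable_pi_apply i)
      measurable_const

/-- Volume of the open `ℓ¹`-ball `{x | ∑ |x i| < R}` in `ι → ℝ`: `2^d · (R^d / d!)` (`d = card ι ≥ 1`,
`R ≥ 0`), read off Mathlib's `MeasureTheory.volume_sum_rpow_lt` at `p = 1`. [folklore] -/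
private theorem volume_sum_abs_lt [Nonempty ι] {R : ℝ} (hR : 0 ≤ R) :
    volume {x : ι → ℝ | ∑ i, |x i| < R} =
      2 ^ Fintype.card ι * ENNReal.ofReal (R ^ Fintype.card ι / (Fintype.card ι).factorial) := by
  have h := MeasureTheory.volume_sum_rpow_lt ι le_rfl R
  have hG : Real.Gamma 2 = 1 := by
    rw [show (2 : ℝ) = (1 : ℕ) + 1 by norm_num, Real.Gamma_nat_eq_factorial, Nat.factorial_one,
      Nat.cast_one]
  simp only [Real.rpow_one, div_one, one_add_one_eq_two, hG, mul_one,
    Real.Gamma_nat_eq_factorial] at h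
  rw [h, ← ENNReal.ofReal_pow hR, ← ENNReal.ofReal_mul (pow_nonneg hR _),
    show R ^ Fintype.card ι * (2 ^ Fintype.card ι / (Fintype.card ι).factorial : ℝ)
      = 2 ^ Fintype.card ι * (R ^ Fintype.card ι / (Fintype.card ι).factorial) by ring,
    ENNReal.ofReal_mul (by positivity), ENNReal.ofReal_pow (by norm_num), ENNReal.ofReal_ofNat]

/-- The open corner simplex `{y | (∀ i, 0 < y i) ∧ ∑ y i < R}` of `ι → ℝ` (`d = card ι ≥ 1`,
`R ≥ 0`) has volume at most `R^d / d!`: its `2^d` coordinate sign-reflections are pairwise disjoint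
inside the `ℓ¹`-ball of radius `R`, of volume `2^d R^d / d!`. (Equality holds; only `≤` is proved.)
The cited source uses the value of this volume for the unit ball of the simplex gauge `‖·‖_{+∞}`
(«Its volume is given by `Vol(B_{+∞}) = d^{d−1/2}/(d−1)!`», hyperplane coordinates).
[cite: DucasPlanconWesolowski2019, §6.2 p. 21] -/
theorem volume_openCornerSimplex_le [Nonempty ι] {R : ℝ} (hR : 0 ≤ R) :
    volume {y : ι → ℝ | (∀ i, 0 < y i) ∧ ∑ i, y i < R} ≤
      ENNReal.ofReal (R ^ Fintype.card ι / (Fintype.card ι).factorial) := by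
  classical
  set S : Set (ι → ℝ) := {y | (∀ i, 0 < y i) ∧ ∑ i, y i < R} with hS_def
  -- the sign reflections, each measure preserving
  let flip : (ι → Bool) → (ι → ℝ) → (ι → ℝ) := fun σ y i => if σ i then y i else -y i
  have hflip_mp : ∀ σ, MeasurePreserving (flip σ) volume volume := by
    intro σ
    have hf : ∀ i, MeasurePreserving (fun t : ℝ => if σ i then t else -t) volume volume := by
      intro i
      rcases Bool.eq_false_or_eq_true (σ i) with h | h
      · simp only [h, if_true]; exact MeasurePreserving.id _
      · simp only [h, Bool.false_eq_true, if_false]; exact Measure.measurePreserving_neg _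
    exact MeasureTheory.volume_preserving_pi hf
  have hSm : MeasurableSet S := measurableSet_openCornerSimplex R
  -- the reflected copies are pairwise disjoint (the sign pattern of `y` determines `σ`)
  have hdisj : Pairwise (Function.onFun Disjoint fun σ : ι → Bool => flip σ ⁻¹' S) := by
    intro σ τ hne
    rw [Function.onFun, Set.disjoint_left]
    intro y hyσ hyτ
    apply hne
    funext i
    have h1 : 0 < (if σ i then y i else -y i) := hyσ.1 i
    have h2 : 0 < (if τ i then y i else -y i) := hyτ.1 i
    rcases Bool.eq_false_or_eq_true (σ i) with hσ | hσ <;>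
      rcases Bool.eq_false_or_eq_true (τ i) with hτ | hτ <;>
      simp only [hσ, hτ, if_true, Bool.false_eq_true, if_false] at h1 h2 ⊢ <;> linarith
  -- and contained in the ℓ¹-ball
  have hsub : (⋃ σ : ι → Bool, flip σ ⁻¹' S) ⊆ {x : ι → ℝ | ∑ i, |x i| < R} := by
    intro y hy
    obtain ⟨σ, hyσ⟩ := Set.mem_iUnion.mp hy
    have h1 : ∀ i, 0 < (if σ i then y i else -y i) := hyσ.1
    have h2 : ∑ i, (if σ i then y i else -y i) < R := hyσ.2
    have heq : ∑ i, |y i| = ∑ i, (if σ i then y i else -y i) := by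
      refine Finset.sum_congr rfl fun i _ => ?_
      have := h1 i
      rcases Bool.eq_false_or_eq_true (σ i) with hσ | hσ <;>
        simp only [hσ, if_true, Bool.false_eq_true, if_false] at this ⊢
      · exact abs_of_pos this
      · rw [abs_of_neg (by linarith)]
    show ∑ i, |y i| < R
    rwa [heq]
  -- count: `2^d · vol S = vol (⋃ reflections) ≤ vol (ℓ¹-ball) = 2^d · R^d / d!`
  have hU : volume (⋃ σ : ι → Bool, flip σ ⁻¹' S) = 2 ^ Fintype.card ι * volume S := by
    rw [measure_iUnion hdisj fun σ => (hflip_mp σ).measurable hSm, tsum_fintype,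
      Finset.sum_congr rfl fun σ _ => (hflip_mp σ).measure_preimage hSm.nullMeasurableSet,
      Finset.sum_const, Finset.card_univ, Fintype.card_fun, Fintype.card_bool, nsmul_eq_mul,
      Nat.cast_pow, Nat.cast_ofNat]
  have key : 2 ^ Fintype.card ι * volume S ≤
      2 ^ Fintype.card ι * ENNReal.ofReal (R ^ Fintype.card ι / (Fintype.card ι).factorial) := by
    rw [← hU, ← volume_sum_abs_lt hR]
    exact measure_mono hsub
  exact (ENNReal.mul_le_mul_iff_right (pow_ne_zero _ two_ne_zero)
    (ENNReal.pow_ne_top ENNReal.ofNat_ne_top)).mp key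

end Simplex

end Literature.Algebra.EuclideanLattices
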